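import Summits.CriticalPhenomena.PercolationContinuityZ3.Theorems.Transplant.SkelNegBChoiceAllT
import Summits.CriticalPhenomena.PercolationContinuityZ3.Theorems.Transplant.SkelNegBParamsLOA
import Summits.CriticalPhenomena.PercolationContinuityZ3.Theorems.Transplant.SkelNegBParamsSchedA
import HarnessLib

/-!
# N1 params, chain of record `NegB`, part ChoiceAllT-A — THE CHOICE FUNCTION OF THE (ζ′) CHAIN **`negChoiceAllOTA gv fv Pv Sv : ChoiceFnNO`** (the twin of `negChoiceAllOT`,
# p30xxxx, over the (ζ′) cells: scheme **`NegB.ΓOTA := cellGeomSG₂b G fineOA fcellsA t (schedOfA …) b0TA`**, arrival boxes **`b0TA i := fcellsA.r i / 4`** (= `10·Kq·s_i`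
# fine cells = `10·Kq` strides: one stride is now `s_i` cells), face data `FDOA := faceDataSG …`, level data `LDOA := levelDataS …`; `δI, m₀, Sz, SMn` EXACTLY as the record's
# (`Neg.δI`, `Neg.m₀`, `Neg.Sz`, `SMnP … Pv` — cell-free), so `AtQO` transfers both ways to `choiceAtOB/OS/OT` and EVERY landed `…_of_atQOB/OS/OT` / `KS.…_R` lemma applies),
# with **`geomHoldsNOFn_negChoiceAllOTA`** for every slot value (stmt-g16 2026-08-22; NEG-SCOPE §B.19 (ζ′); p3-g11 rulings 02:53:30Z (plan adopted) and 03:03:22Z (Q-ζ1: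
# `negChoiceAllOTA : ChoiceFnNO` over `κ : Consts`, δI as today, NO δC — the closure of record for it is the length-budgeted `…_of_choiceFnNOWL NegB.LfA`))
HOW TO INSTANTIATE (the NOWL tuple, values of record as they land): `negChoiceAllOTA (KS.gT 0 gxA) (KS.fT 0 fxA) (KS.PR 0 PxA) (SUA exA mxA)` — this file is slot-generic.
builds on p205010 (kernel theorem, internal audit signed; external expert review pending) — nothing in this file uses p205010; NOTHING is claimed about the node
`SamePDropOfSkeletonNeg₁` (OPEN).
Lane `prim-bschramm-*`, seat `prim-bschramm-stmt` (gen 16); helper file (`--supports stmt-CriticalPhenomena-4575 --as helper`); ledger HOME/prim-bschramm-stmt/NEG-PARAMS.md.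
* §1 **`b0TA`** (`b0TA_eq : = 10·Kq·s i`, `b0TA_le : ≤ 3·r i`, `b0TA_ge`, `b0TA_le_two`), **`ΓOTA`**, **`FDOA`**, **`LDOA`**, `choiceAtOTA`, **`negChoiceAllOTA`** (+ `_eq`);
* §2 **`atQOB_of_atQOTA`** / `atQOTA_of_atQOB` / **`atQOS_of_atQOTA`** / **`atQOT_of_atQOTA`**, `factsO/eqNumL/clauseL/clauseS/clauseP/inputsP/inputsExtra/inputsS/inputsL/zone _of_atQOTA`;
* §3 `geom_fineA_at_b` (any `b₀ ≤ 3r`), **`geomHoldsNOFn_negChoiceAllOTA`**.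
[cite: KozmaNitzan2024, §4 Theorem 6 (pp. 25–31); pp. 25–29] [cite: MartineauTassion2017, §3.2 Lemma 3.5, §4.3]
-/

noncomputable section

open scoped Classical

namespace Summit.CriticalPhenomena.PercolationContinuityZ3.Theorems.Transplant

open MeasureTheory Literature.Probability.Percolation Literature.Probability.LatticeModels SimpleGraph KNCells
open Literature.Barriers.CriticalPhenomena (HasExponentialGrowth)

namespace PlanarSkeletonNeg

open SkelConc (Consts)
open BoxProdZ2 (ConcRadiiG)
open Skelφ (oriφ trφ)
open Skelφ.StepI (DataN OutO)

namespace NegB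

open Neg

/-! ## §1 The arrival boxes, the scheme, the choice function of the (ζ′) chain -/

section Values

variable (κ : Consts) {V : Type} [DecidableEq V] [Countable V] {G : SimpleGraph V} [G.LocallyFinite] (Φ : PlanarSkeletonNeg G) (t : V)
  (p : unitInterval) (D : DataN V) (g f : ℕ)

/-- **THE ARRIVAL-BOX HALF-WIDTHS OF THE (ζ′) CHAIN** (in fine cells): `b0TA i := fcellsA.r i / 4` (`= 10·Kq·s_i` = `10·Kq` strides, one stride = `s_i` cells). [this work] -/
def b0TA : Fin 2 → ℕ := fun i => (fcellsA κ Φ t p D g f).r i / 4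

/-- `b0TA i = r i / 4` (by `rfl`). [folklore] -/
theorem b0TA_eq_div (i : Fin 2) : b0TA κ Φ t p D g f i = (fcellsA κ Φ t p D g f).r i / 4 := rfl

/-- **`b0TA i = 10·Kq·s_i`** (`K = 40·Kq`, `r i = K·s i`). [folklore] -/
theorem b0TA_eq (i : Fin 2) : b0TA κ Φ t p D g f i = 10 * Neg.Kq κ * (fcellsA κ Φ t p D g f).s i := by
  have hr := (fcellsA_K κ Φ t p D g f).2.2 i
  rw [b0TA_eq_div, hr, Neg.K_eq]
  have : 40 * Neg.Kq κ * (fcellsA κ Φ t p D g f).s i = 4 * (10 * Neg.Kq κ * (fcellsA κ Φ t p D g f).s i) := by ring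
  rw [this, Nat.mul_div_cancel_left _ (by norm_num)]

/-- **`b0TA i ≤ 3·r i`** (hp-8's `hb`). [folklore] -/
theorem b0TA_le (i : Fin 2) : b0TA κ Φ t p D g f i ≤ 3 * (fcellsA κ Φ t p D g f).r i := by
  rw [b0TA_eq_div]; omega

/-- `8·Kq·s i ≤ b0TA i` and `1 ≤ b0TA i`. [folklore] -/
theorem b0TA_ge (i : Fin 2) : 8 * Neg.Kq κ * (fcellsA κ Φ t p D g f).s i ≤ b0TA κ Φ t p D g f i ∧ 1 ≤ b0TA κ Φ t p D g f i := by
  rw [b0TA_eq]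
  have hK : 1 ≤ Neg.Kq κ := Neg.one_le_Kq κ
  have hs : 1 ≤ (fcellsA κ Φ t p D g f).s i := (fcellsA κ Φ t p D g f).hs i
  refine ⟨by nlinarith, ?_⟩
  calc 1 ≤ 10 * 1 * 1 := by norm_num
    _ ≤ 10 * Neg.Kq κ * (fcellsA κ Φ t p D g f).s i := Nat.mul_le_mul (Nat.mul_le_mul_left _ hK) hs

/-- `b0TA i ≤ 2·r i` and `r i ≤ 4·b0TA i + 3`. [folklore] -/
theorem b0TA_le_two (i : Fin 2) : b0TA κ Φ t p D g f i ≤ 2 * (fcellsA κ Φ t p D g f).r i ∧ (fcellsA κ Φ t p D g f).r i ≤ 4 * b0TA κ Φ t p D g f i + 3 := by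
  rw [b0TA_eq_div]; omega

variable (O : OutO V) (gv fv : Neg.FSlot) (Sv : SSlot) (q : unitInterval)

/-- **THE SCHEME OF RECORD OF THE (ζ′) CHAIN at `(O, q)`**: `cellGeomSG₂b` over the oriented (ζ′) fine map `fineOA`, the cells `fcellsA`, root `t`, schedule `schedOfA (Sv …)`,
boxes `b0TA`. [cite: KozmaNitzan2024, §4 pp. 25–27 (Q_v, M_v, E_{v,x}, H^j_{v,x})] -/
def ΓOTA : CellGeom V ℕ :=
  Skelφ.cellGeomSG₂b G (fineOA κ Φ t p O.D O.DT O.ori (gOf κ Φ t p O gv) (fOf κ Φ t p O fv))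
    (fcellsA κ Φ t p O.merged (gOf κ Φ t p O gv) (fOf κ Φ t p O fv)) t
    (schedOfA κ Φ t p O.merged (gOf κ Φ t p O gv) (fOf κ Φ t p O fv) (Sv κ Φ t p O.merged (gOf κ Φ t p O gv) (fOf κ Φ t p O fv) q))
    (b0TA κ Φ t p O.merged (gOf κ Φ t p O gv) (fOf κ Φ t p O fv))

/-- **The face data of the (ζ′) chain at `(O, q)`** (`faceDataSG` over `fineOA`/`fcellsA`/`schedOfA`). [this work] -/
def FDOA : FaceData V ℕ :=
  Skelφ.faceDataSG G (fineOA κ Φ t p O.D O.DT O.ori (gOf κ Φ t p O gv) (fOf κ Φ t p O fv))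
    (fcellsA κ Φ t p O.merged (gOf κ Φ t p O gv) (fOf κ Φ t p O fv)) t
    (schedOfA κ Φ t p O.merged (gOf κ Φ t p O gv) (fOf κ Φ t p O fv) (Sv κ Φ t p O.merged (gOf κ Φ t p O gv) (fOf κ Φ t p O fv) q))

/-- **The level data of the (ζ′) chain at `O`** (`levelDataS` over `fineOA`/`fcellsA`). [this work] -/
def LDOA : LevelData V ℕ :=
  Skelφ.levelDataS (fineOA κ Φ t p O.D O.DT O.ori (gOf κ Φ t p O gv) (fOf κ Φ t p O fv)) (fcellsA κ Φ t p O.merged (gOf κ Φ t p O gv) (fOf κ Φ t p O fv))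

variable (hC : Φ.CylSubcritical p) (Pv : PSlot)

/-- **THE N1 CHOICES OF THE (ζ′) CHAIN at `(κ, Φ, t, p)` with the four slots** — `δI, m₀, Sz, SMn` as the record's, `Γ := ΓOTA`, `FD := FDOA`, `LD := LDOA`.
[cite: KozmaNitzan2024, §4 Theorem 6 (pp. 25–31)] -/
def choiceAtOTA : ChoiceNO κ Φ t p hC where
  δI := Neg.δI κ Φ
  m₀ := Neg.m₀
  Sz := fun O => Neg.Sz O.merged
  SMn := fun O => SMnP κ Φ t p O.merged (gOf κ Φ t p O gv) (fOf κ Φ t p O fv) Pv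
  Γ := fun O q => ΓOTA κ Φ t p O gv fv Sv q
  FD := fun O q => FDOA κ Φ t p O gv fv Sv q
  LD := fun O _ => LDOA κ Φ t p O gv fv
  δI_pos := Neg.δI_pos κ Φ
  δI_lt_one := Neg.δI_lt_one κ Φ
  S_adm := fun O _ => ⟨Neg.Sz_adm O.merged, SMnP_adm_at κ Φ t p O.merged _ _ Pv⟩

end Values

end NegB

/-- **THE CHOICE FUNCTION OF THE {±1} NODE FOR THE (ζ′) CHAIN, four slots** (box `gv`, width `fv`, extra pairs `Pv`, fibre block `Sv`): a `ChoiceFnNO` over `κ : Consts`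
(the closure for it is the length-budgeted `samePDropOfSkeletonNeg₁_of_choiceFnNOWL NegB.LfA`). [cite: KozmaNitzan2024, §4 Theorem 6 (pp. 25–31)] -/
def negChoiceAllOTA (gv fv : Neg.FSlot) (Pv : NegB.PSlot) (Sv : NegB.SSlot) : ChoiceFnNO :=
  fun κ _ _ _ _ _ Φ _ t _ _ p _ _ hC => NegB.choiceAtOTA κ Φ t p gv fv Sv hC Pv

/-- `negChoiceAllOTA` unfolds to `NegB.choiceAtOTA` (by `rfl`). [folklore] -/
theorem negChoiceAllOTA_eq (gv fv : Neg.FSlot) (Pv : NegB.PSlot) (Sv : NegB.SSlot) (κ : Consts) {V : Type} [DecidableEq V] [Countable V] (G : SimpleGraph V)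
    [G.LocallyFinite] (Φ : PlanarSkeletonNeg G) (hg : ¬ HasExponentialGrowth G) (t : V) (ht : t ∈ Φ.types) (h1 : Φ.types = {t}) (p : unitInterval)
    (hp0 : 0 < (p : ℝ)) (hp1 : (p : ℝ) < 1) (hC : Φ.CylSubcritical p) :
    negChoiceAllOTA gv fv Pv Sv κ G Φ hg t ht h1 p hp0 hp1 hC = NegB.choiceAtOTA κ Φ t p gv fv Sv hC Pv := rfl

/-! ## §2 Unpacking `AtQO` for the (ζ′) choices (`AtQO` reads only `δI, m₀, Sz, SMn`, which are the record's) -/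

namespace NegB

open Neg

section AtQ

variable {κ : Consts} {V : Type} [DecidableEq V] [Countable V] {G : SimpleGraph V} [G.LocallyFinite] {Φ : PlanarSkeletonNeg G} {t : V} {p : unitInterval}
  {hC : Φ.CylSubcritical p} {gv fv : Neg.FSlot} {Pv : PSlot} {Sv : SSlot} {O : OutO V} {q : unitInterval}

/-- `FactsO`, the density window and Φ2 at `q` out of `AtQO`. [folklore] -/
theorem factsO_of_atQOTA (hAt : (choiceAtOTA κ Φ t p gv fv Sv hC Pv).AtQO O q) :
    O.FactsO Φ.frame hC Neg.m₀ t ∧ (p : ℝ) / 2 ≤ q ∧ (q : ℝ) ≤ p ∧ Φ.CylSubcritical q := ⟨hAt.1, hAt.2.1, hAt.2.2.1, hAt.2.2.2.2⟩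

/-- **`AtQO` of the (ζ′) choices gives `AtQO` of the record's fat-box choices** (same `δI, m₀, Sz, SMn`) — so EVERY `…_of_atQOB` lemma applies after it. (Componentwise: the
kernel must never compare the two schemes.) [folklore] -/
theorem atQOB_of_atQOTA (hAt : (choiceAtOTA κ Φ t p gv fv Sv hC Pv).AtQO O q) : (choiceAtOB κ Φ t p Pv gv fv Sv hC).AtQO O q := by
  obtain ⟨h1, h2, h3, h4, h5⟩ := hAt
  have h1' : O.FactsO Φ.frame hC Neg.m₀ t := h1
  have h4' : ∀ i ∈ Skelφ.StepI.indexNP {t} (Neg.Sz O.merged) (SMnP κ Φ t p O.merged (gOf κ Φ t p O gv) (fOf κ Φ t p O fv) Pv),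
      1 - Neg.δI κ Φ < (bondPercolation G q).real (Skelφ.StepI.eventO G Φ.φ O.D O.DT O.ori i) := h4
  exact ⟨h1', h2, h3, h4', h5⟩

/-- The converse transfer. [folklore] -/
theorem atQOTA_of_atQOB (hAt : (choiceAtOB κ Φ t p Pv gv fv Sv hC).AtQO O q) : (choiceAtOTA κ Φ t p gv fv Sv hC Pv).AtQO O q := by
  obtain ⟨h1, h2, h3, h4, h5⟩ := hAt
  have h1' : O.FactsO Φ.frame hC Neg.m₀ t := h1
  have h4' : ∀ i ∈ Skelφ.StepI.indexNP {t} (Neg.Sz O.merged) (SMnP κ Φ t p O.merged (gOf κ Φ t p O gv) (fOf κ Φ t p O fv) Pv),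
      1 - Neg.δI κ Φ < (bondPercolation G q).real (Skelφ.StepI.eventO G Φ.φ O.D O.DT O.ori i) := h4
  exact ⟨h1', h2, h3, h4', h5⟩

/-- **`AtQO` of the (ζ′) choices gives `AtQO` of the record's S1 choices** — so every landed `…_of_atQOS` / `KS.…_R` lemma applies after it. [folklore] -/
theorem atQOS_of_atQOTA (hAt : (choiceAtOTA κ Φ t p gv fv Sv hC Pv).AtQO O q) : (choiceAtOS κ Φ t p gv fv Sv hC Pv).AtQO O q :=
  atQOS_of_atQOB (atQOB_of_atQOTA hAt)

/-- **`AtQO` of the (ζ′) choices gives `AtQO` of the record's T choices** — so every landed `…_of_atQOT` lemma applies after it. [folklore] -/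
theorem atQOT_of_atQOTA (hAt : (choiceAtOTA κ Φ t p gv fv Sv hC Pv).AtQO O q) : (choiceAtOT κ Φ t p gv fv Sv hC Pv).AtQO O q :=
  atQOT_of_atQOB (atQOB_of_atQOTA hAt)

/-- The numeric long clause at the merged record out of `AtQO`. [folklore] -/
theorem eqNumL_of_atQOTA (hAt : (choiceAtOTA κ Φ t p gv fv Sv hC Pv).AtQO O q) : EqNumL κ Φ t p O.merged (gOf κ Φ t p O gv) (fOf κ Φ t p O fv) :=
  eqNumL_of_atQOB (atQOB_of_atQOTA hAt)

/-- The long clause (oriented map `φL`, `|h_L| ≤ 10 n_L`) out of `AtQO`. [folklore] -/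
theorem clauseL_of_atQOTA (hAt : (choiceAtOTA κ Φ t p gv fv Sv hC Pv).AtQO O q) :
    O.merged.EqGeom G (φL κ Φ t p O.D O.DT O.ori (gOf κ Φ t p O gv) (fOf κ Φ t p O fv)) t (ML κ Φ t p O.merged (gOf κ Φ t p O gv))
        (nL κ Φ t p O.merged (gOf κ Φ t p O gv) (fOf κ Φ t p O fv)) ∧
      (hL κ Φ t p O.merged (gOf κ Φ t p O gv) (fOf κ Φ t p O fv)).natAbs ≤ 10 * nL κ Φ t p O.merged (gOf κ Φ t p O gv) (fOf κ Φ t p O fv) :=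
  clauseL_of_atQOB (atQOB_of_atQOTA hAt)

/-- The short clause out of `AtQO`. [folklore] -/
theorem clauseS_of_atQOTA (hAt : (choiceAtOTA κ Φ t p gv fv Sv hC Pv).AtQO O q) :
    O.merged.EqGeom G (φS t O.D O.DT O.ori (Φ := Φ)) t (Mu O.merged) (nS O.merged) ∧ (hS t O.merged).natAbs ≤ 10 * nS O.merged :=
  clauseS_of_atQOB (atQOB_of_atQOTA hAt)

/-- The clause of ANY admissible pair out of `AtQO`. [folklore] -/
theorem clauseP_of_atQOTA (hAt : (choiceAtOTA κ Φ t p gv fv Sv hC Pv).AtQO O q) {M n : ℕ} (hM : O.D.M₀ ≤ M) (hn : O.D.n₁ M ≤ n) :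
    O.merged.EqGeom G (oriφ Φ.φ (O.ori t M n)) t M n ∧ (O.merged.hgt t M n).natAbs ≤ 10 * n :=
  clauseP_of_atQOB (atQOB_of_atQOTA hAt) hM hn

/-- The piece-links of any listed pair at `q`. [folklore] -/
theorem inputsP_of_atQOTA (hAt : (choiceAtOTA κ Φ t p gv fv Sv hC Pv).AtQO O q) {M n : ℕ}
    (hMn : (M, n) ∈ SMnP κ Φ t p O.merged (gOf κ Φ t p O gv) (fOf κ Φ t p O fv) Pv) (fam : Fin 2) (σ τ : ℤˣ) :
    1 - Neg.δI κ Φ < (bondPercolation G q).real (Skelφ.StepI.eventN G (oriφ Φ.φ (O.ori t M n)) O.merged (t, M, some (n, fam, σ, τ))) :=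
  inputsP_of_atQOB (atQOB_of_atQOTA hAt) hMn fam σ τ

/-- The extra pairs' piece-links. [folklore] -/
theorem inputsExtra_of_atQOTA (hAt : (choiceAtOTA κ Φ t p gv fv Sv hC Pv).AtQO O q) {M n : ℕ} (hMn : (M, n) ∈ (Pv κ Φ t p O.merged).1) (fam : Fin 2)
    (σ τ : ℤˣ) :
    1 - Neg.δI κ Φ < (bondPercolation G q).real (Skelφ.StepI.eventN G (oriφ Φ.φ (O.ori t M n)) O.merged (t, M, some (n, fam, σ, τ))) :=
  inputsExtra_of_atQOB (atQOB_of_atQOTA hAt) hMn fam σ τ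

/-- The short pair's piece-links. [folklore] -/
theorem inputsS_of_atQOTA (hAt : (choiceAtOTA κ Φ t p gv fv Sv hC Pv).AtQO O q) (fam : Fin 2) (σ τ : ℤˣ) :
    1 - Neg.δI κ Φ <
      (bondPercolation G q).real (Skelφ.StepI.eventN G (φS t O.D O.DT O.ori (Φ := Φ)) O.merged (t, Mu O.merged, some (nS O.merged, fam, σ, τ))) :=
  inputsS_of_atQOB (atQOB_of_atQOTA hAt) fam σ τ

/-- The long pair's piece-links. [folklore] -/
theorem inputsL_of_atQOTA (hAt : (choiceAtOTA κ Φ t p gv fv Sv hC Pv).AtQO O q) (fam : Fin 2) (σ τ : ℤˣ) :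
    1 - Neg.δI κ Φ <
      (bondPercolation G q).real (Skelφ.StepI.eventN G (φL κ Φ t p O.D O.DT O.ori (gOf κ Φ t p O gv) (fOf κ Φ t p O fv)) O.merged
        (t, ML κ Φ t p O.merged (gOf κ Φ t p O gv), some (nL κ Φ t p O.merged (gOf κ Φ t p O gv) (fOf κ Φ t p O fv), fam, σ, τ))) :=
  inputsL_of_atQOB (atQOB_of_atQOTA hAt) fam σ τ

/-- The uniqueness zone at `M_u`. [folklore] -/
theorem zone_of_atQOTA (hAt : (choiceAtOTA κ Φ t p gv fv Sv hC Pv).AtQO O q) :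
    1 - Neg.δI κ Φ < (bondPercolation G q).real (Skelφ.StepI.eventN G (φS t O.D O.DT O.ori (Φ := Φ)) O.merged (t, Mu O.merged, none)) :=
  zone_of_atQOB (atQOB_of_atQOTA hAt)

end AtQ

/-! ## §3 The geometric obligation of the (ζ′) choices -/

section Geom

variable (κ : Consts) {V : Type} [DecidableEq V] [Countable V] {G : SimpleGraph V} [G.LocallyFinite] (Φ : PlanarSkeletonNeg G) (t : V)
  (p : unitInterval) (D : DataN V) (g f : ℕ)

/-- **THE NINE `GeomHoldsN` CONJUNCTS FOR THE (ζ′) CELLS WITH SMALL BOXES, map slot `φ′`** (`cellGeomSG₂b … b₀` for any `b₀ ≤ 3r`). [cite: KozmaNitzan2024, §4 pp. 25–29] -/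
theorem geom_fineA_at_b {φ' : V → Site 2} (hlip : Skelφ.Lip G φ') (hstep : Skelφ.Steps G φ') (hN : EqNumL κ Φ t p D g f) {Λ : ConcRadiiG}
    (hΛ : Skelφ.WFS2 (fcellsA κ Φ t p D g f) Λ) (hcolQ : ∀ a x, NrepA κ Φ t p D g f ((fcellsA κ Φ t p D g f).cen x) + 1 ≤ Λ.rQ a x)
    {b₀ : Fin 2 → ℕ} (hb : ∀ i, b₀ i ≤ 3 * (fcellsA κ Φ t p D g f).r i) :
    (Skelφ.cellGeomSG₂b G (fineA κ Φ t p D g f φ') (fcellsA κ Φ t p D g f) t Λ b₀).root = t ∧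
      κ.K₀ ≤ (Skelφ.cellGeomSG₂b G (fineA κ Φ t p D g f φ') (fcellsA κ Φ t p D g f) t Λ b₀).K ∧
      Skelφ.Lip G (fineA κ Φ t p D g f φ') ∧
      RunGeom G (Skelφ.cellGeomSG₂b G (fineA κ Φ t p D g f φ') (fcellsA κ Φ t p D g f) t Λ b₀) ∧
      AnchGeom (Skelφ.cellGeomSG₂b G (fineA κ Φ t p D g f φ') (fcellsA κ Φ t p D g f) t Λ b₀) ∧
      SepGeom₂ G (Skelφ.cellGeomSG₂b G (fineA κ Φ t p D g f φ') (fcellsA κ Φ t p D g f) t Λ b₀) ∧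
      ExitGeom G (Skelφ.cellGeomSG₂b G (fineA κ Φ t p D g f φ') (fcellsA κ Φ t p D g f) t Λ b₀) ∧
      StepsGeom (Skelφ.cellGeomSG₂b G (fineA κ Φ t p D g f φ') (fcellsA κ Φ t p D g f) t Λ b₀)
        (Skelφ.faceDataSG G (fineA κ Φ t p D g f φ') (fcellsA κ Φ t p D g f) t Λ) ∧
      LevelGeom G (Skelφ.cellGeomSG₂b G (fineA κ Φ t p D g f φ') (fcellsA κ Φ t p D g f) t Λ b₀)
        (Skelφ.faceDataSG G (fineA κ Φ t p D g f φ') (fcellsA κ Φ t p D g f) t Λ) (Skelφ.levelDataS (fineA κ Φ t p D g f φ') (fcellsA κ Φ t p D g f)) := by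
  have hψ0 := fineA_base_at κ Φ t p D g f φ' hN
  have hlipψ := lip_fineA_at κ Φ t p D g f hlip hN
  have hws := weakSteps_fineA_at κ Φ t p D g f hstep hN
  have hcol := hcol_fineA_of_sched κ Φ t p D g f hlip hstep hN hcolQ
  refine ⟨rfl, (fcellsA_K κ Φ t p D g f).2.1, hlipψ, Skelφ.runGeomSG₂b _ _ _, Skelφ.anchGeomSG₂b _ _ _, Skelφ.sepGeom₂SG₂b _ _ _ hΛ hψ0 hlipψ hws hcol,
    Skelφ.exitGeomSG₂b _ _ _ hΛ hlipψ hb, Skelφ.stepsGeomSG₂b _ _ _ hΛ hlipψ hws hb, Skelφ.levelGeomSG₂b _ _ _ hΛ hlipψ hb⟩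

end Geom

end NegB

/-- **`GeomHoldsNOFn (negChoiceAllOTA gv fv Pv Sv)` FOR EVERY SLOT VALUE** (the (ζ′) scheme; `b0TA ≤ 3r` by `b0TA_le`). [cite: KozmaNitzan2024, §4 pp. 25–29] -/
theorem geomHoldsNOFn_negChoiceAllOTA (gv fv : Neg.FSlot) (Pv : NegB.PSlot) (Sv : NegB.SSlot) : GeomHoldsNOFn (negChoiceAllOTA gv fv Pv Sv) := by
  intro κ V _ _ G _ Φ hg t ht h1 p hp0 hp1 hC O q hAt
  obtain ⟨-, -, hR, -, -⟩ := hAt.1.shared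
  obtain ⟨h1', h2, -, h4, h5, h6, h7, h8, h9⟩ := NegB.geom_fineA_at_b κ Φ t p O.merged (NegB.gOf κ Φ t p O gv) (NegB.fOf κ Φ t p O fv)
    (NegB.lip_φL κ Φ t p O.D O.DT O.ori (NegB.gOf κ Φ t p O gv) (NegB.fOf κ Φ t p O fv))
    (NegB.steps_φL κ Φ t p O.D O.DT O.ori (NegB.gOf κ Φ t p O gv) (NegB.fOf κ Φ t p O fv))
    (NegB.eqNumL_of_factsO κ Φ t p O.D O.DT O.ori _ _ hR hAt.1.clauses)
    (NegB.schedOfA_WFS2 κ Φ t p O.merged (NegB.gOf κ Φ t p O gv) (NegB.fOf κ Φ t p O fv)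
      (Sv κ Φ t p O.merged (NegB.gOf κ Φ t p O gv) (NegB.fOf κ Φ t p O fv) q))
    (NegB.colQ_schedOfA κ Φ t p O.merged (NegB.gOf κ Φ t p O gv) (NegB.fOf κ Φ t p O fv)
      (Sv κ Φ t p O.merged (NegB.gOf κ Φ t p O gv) (NegB.fOf κ Φ t p O fv) q))
    (NegB.b0TA_le κ Φ t p O.merged (NegB.gOf κ Φ t p O gv) (NegB.fOf κ Φ t p O fv))
  exact ⟨h1', h2, h4, h5, h6, h7, h8, h9⟩

end PlanarSkeletonNeg

end Summit.CriticalPhenomena.PercolationContinuityZ3.Theorems.Transplant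

end
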